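import Summits.ResolutionOfSingularities.ResolutionOfSingularities.Theses.WeightedInvariant

/-!
# Route WeightedInvariant — Assembly (item stmt-ResolutionOfSingularities-0570)

The assembly item of route `WeightedInvariant` reads

  `Assembly := WeightedThesis → DescentPerfectToAll → ResolutionOfSingularities`.

Since `ResolutionOfSingularities = ∀ p, p.Prime → ResolutionInChar p`, and `DescentPerfectToAll`
turns, prime by prime, resolution over all perfect fields of characteristic `p` (which is exactly
what `WeightedThesis` supplies at `p`) into `ResolutionInChar p`, the assembly is modus ponens,
prime by prime — the same term as the route's deciding theorem `closes`. All the mathematics of the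
route lives in the two hypotheses (items stmt-0569 and stmt-0549).
-/

namespace Summit.ResolutionOfSingularities.ResolutionOfSingularities.Theorems

open Summit.ResolutionOfSingularities.ResolutionOfSingularities.Theses.WeightedInvariant

/-- **Assembly of route WeightedInvariant** (item stmt-ResolutionOfSingularities-0570):
resolution of every reduced separated finite-type scheme over every perfect field of every prime
characteristic (`WeightedThesis`), together with the descent step "perfect fields ⇒ all fields of
characteristic `p`" (`DescentPerfectToAll`), gives `ResolutionOfSingularities`. Proof: for a prime
`p`, feed `WeightedThesis` at `p` into `DescentPerfectToAll` at `p`. -/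
theorem Assembly_proof :
    Summit.ResolutionOfSingularities.ResolutionOfSingularities.Theses.WeightedInvariant.Assembly := by
  unfold Assembly
  intro hT hD p hp
  exact hD p hp (hT p hp)

end Summit.ResolutionOfSingularities.ResolutionOfSingularities.Theorems
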